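import Literature.Analysis.Complex.ArcInversion
import Literature.Analysis.Complex.KoebeQuarterProofs
import Literature.Analysis.Complex.KoebeDistortion
import Mathlib.Analysis.Complex.Schwarz
import HarnessLib

/-!
# Quantitative bounds for the Green function of the complement of a Jordan arc

Continuation of `ArcInversion`: for a Jordan arc `L` (`e : [0,1] ≃ₜ L`, initial point
`a = e 0`, final point `b = e 1`), the Green function `g = arcGreen e` of `ℂ ∖ L` with pole at
`∞`, `g(w) = -log ‖φ(T w)‖`, `T w = (w - a)⁻¹`, `φ` the Riemann map of `Ω' = arcInv L a` with
`φ(0) = 0` and inverse `ψ`. All constants are explicit in a radius `R` with `L ⊆ B̄(a, R)`: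

* Schwarz's lemma on `B(0, R⁻¹) ⊆ Ω'`: `‖φ ζ‖ ≤ R‖ζ‖`, `‖φ'(0)‖ ≤ R`, `‖ψ'(0)‖ ≥ R⁻¹`; hence the
  **far lower bound** `g(w) ≥ log 2` for `‖w - a‖ ≥ 2R` (`le_arcGreen_of_far`);
* Koebe's one-quarter theorem at a general point (`koebeQuarter_holds` composed with the disc
  automorphism `Complex.discMobius`): `B(ψ η, ‖ψ'(η)‖(1 - ‖η‖²)/4) ⊆ Ω'`; with `T b ∉ Ω'`,
  `‖ψ'(0)‖ ≤ 4/‖b - a‖`; with the growth theorem (`norm_sub_le_growth`) the **global upper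
  bound** `g(w) ≤ max (log 2) (log (16‖w - a‖/‖b - a‖))` (`arcGreen_le_max_log`);
* with the distortion theorem (`distortion_le_norm_deriv`) the **modulus of continuity at the
  arc**: for `x ∈ L ∖ {a}`, `(1 - ‖φ(Tw)‖)² ≤ 32R‖w - x‖/(‖w - a‖‖x - a‖)`, whence
  `g(w) ≤ 2√(32R‖w - x‖/(‖w - a‖‖x - a‖))` once the radicand is `≤ 1/4`
  (`arcGreen_le_of_near`).

These feed the single-scale harmonic-measure estimate behind [LSW] Lemma 6.3
(`Literature/Probability/RandomPlanarGeometry`). References: Ch. Pommerenke, *Boundary Behaviour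
of Conformal Maps* (1992), Thm. 1.3 and Cor. 1.4 (Koebe distortion, one-quarter theorem).
-/

noncomputable section

open Set Filter Metric Topology Function Complex
open scoped unitInterval ComplexConjugate

namespace Literature.Analysis.Complex

variable {L : Set ℂ} (e : I ≃ₜ L)

/-! ### The inverse Riemann map -/

/-- The inverse `ψ = invFunOn φ Ω'` of the Riemann map: holomorphic and injective on `𝔻`,
`ψ(0) = 0`, `ψ(𝔻) = Ω'`, `φ ∘ ψ = id` on `𝔻`, `ψ ∘ φ = id` on `Ω'`. [folklore] -/
theorem arcRiemannInv_spec :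
    DifferentiableOn ℂ (invFunOn (arcRiemannMap e) (arcInv L ((e 0 : L) : ℂ))) (ball 0 1) ∧
    InjOn (invFunOn (arcRiemannMap e) (arcInv L ((e 0 : L) : ℂ))) (ball 0 1) ∧
    invFunOn (arcRiemannMap e) (arcInv L ((e 0 : L) : ℂ)) 0 = 0 ∧
    invFunOn (arcRiemannMap e) (arcInv L ((e 0 : L) : ℂ)) '' ball 0 1 = arcInv L ((e 0 : L) : ℂ) ∧
    (∀ η ∈ ball (0 : ℂ) 1, arcRiemannMap e (invFunOn (arcRiemannMap e) (arcInv L ((e 0 : L) : ℂ)) η) = η) ∧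
    ∀ ζ ∈ arcInv L ((e 0 : L) : ℂ), invFunOn (arcRiemannMap e) (arcInv L ((e 0 : L) : ℂ)) (arcRiemannMap e ζ) = ζ := by
  obtain ⟨-, hbij, h0, -, hinvd⟩ := arcRiemannMap_spec e
  have hinv := hbij.invOn_invFunOn
  refine ⟨hinvd, ?_, ?_, ?_, fun η hη ↦ hinv.2 hη, fun ζ hζ ↦ hinv.1 hζ⟩
  · exact hinv.2.injOn.mono (fun η hη ↦ hη)
  · have := hinv.1 zero_mem_arcInv
    rwa [h0] at this
  · exact (hinv.symm.bijOn hbij.surjOn.mapsTo_invFunOn hbij.mapsTo).image_eq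

/-- The derivatives of `φ` at `0` and of `ψ` at `0` are inverse to each other. [folklore] -/
theorem deriv_arcRiemannMap_mul_deriv_inv :
    deriv (arcRiemannMap e) 0 * deriv (invFunOn (arcRiemannMap e) (arcInv L ((e 0 : L) : ℂ))) 0 = 1 := by
  obtain ⟨hφd, -, -, -, -⟩ := arcRiemannMap_spec e
  obtain ⟨hψd, -, hψ0, -, hφψ, -⟩ := arcRiemannInv_spec e
  set ψ := invFunOn (arcRiemannMap e) (arcInv L ((e 0 : L) : ℂ)) with hψ
  have hopen := isOpen_arcInv (a := ((e 0 : L) : ℂ)) (isCompact_arc e)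
  have h1 : HasDerivAt ψ (deriv ψ 0) 0 := (hψd.differentiableAt (ball_mem_nhds 0 one_pos)).hasDerivAt
  have h2 : HasDerivAt (arcRiemannMap e) (deriv (arcRiemannMap e) 0) (ψ 0) := by
    rw [hψ0]
    exact (hφd.differentiableAt (hopen.mem_nhds zero_mem_arcInv)).hasDerivAt
  have h3 : HasDerivAt (fun η ↦ arcRiemannMap e (ψ η)) (deriv (arcRiemannMap e) 0 * deriv ψ 0) 0 :=
    h2.comp 0 h1
  have h4 : HasDerivAt (fun η ↦ arcRiemannMap e (ψ η)) 1 0 := by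
    refine (hasDerivAt_id (0 : ℂ)).congr_of_eventuallyEq ?_
    filter_upwards [ball_mem_nhds (0 : ℂ) one_pos] with η hη
    exact hφψ η hη
  exact h3.unique h4

/-! ### Schwarz near the origin: the far lower bound -/

section Schwarz

variable {R : ℝ} (hR : 0 < R) (hL : L ⊆ closedBall ((e 0 : L) : ℂ) R)
include hR hL

/-- `φ` maps the disc `B(0, R⁻¹) ⊆ Ω'` into `𝔻` fixing `0`, so `‖φ ζ‖ ≤ R‖ζ‖` there. [folklore] -/
theorem norm_arcRiemannMap_le {ζ : ℂ} (hζ : ‖ζ‖ < R⁻¹) : ‖arcRiemannMap e ζ‖ ≤ R * ‖ζ‖ := by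
  obtain ⟨hφd, hbij, h0, -, -⟩ := arcRiemannMap_spec e
  have hsub := ball_subset_arcInv hR hL
  have hmaps : MapsTo (arcRiemannMap e) (ball 0 R⁻¹) (closedBall (arcRiemannMap e 0) 1) := by
    intro ξ hξ
    rw [h0]
    exact ball_subset_closedBall (hbij.mapsTo (hsub hξ))
  have h := Complex.dist_le_div_mul_dist_of_mapsTo_ball (hφd.mono hsub) hmaps (mem_ball_zero_iff.2 hζ)
  rw [h0, dist_zero_right, dist_zero_right, div_inv_eq_mul, one_mul] at h
  exact h

/-- `‖φ'(0)‖ ≤ R`. [folklore] -/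
theorem norm_deriv_arcRiemannMap_zero_le : ‖deriv (arcRiemannMap e) 0‖ ≤ R := by
  obtain ⟨hφd, hbij, h0, -, -⟩ := arcRiemannMap_spec e
  have hsub := ball_subset_arcInv hR hL
  have hmaps : MapsTo (arcRiemannMap e) (ball 0 R⁻¹) (closedBall (arcRiemannMap e 0) 1) := by
    intro ξ hξ
    rw [h0]
    exact ball_subset_closedBall (hbij.mapsTo (hsub hξ))
  have h := Complex.norm_deriv_le_div_of_mapsTo_ball (hφd.mono hsub) hmaps (inv_pos.2 hR)
  rwa [div_inv_eq_mul, one_mul] at h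

/-- `‖ψ'(0)‖ ≥ R⁻¹`. [folklore] -/
theorem inv_le_norm_deriv_arcRiemannInv_zero :
    R⁻¹ ≤ ‖deriv (invFunOn (arcRiemannMap e) (arcInv L ((e 0 : L) : ℂ))) 0‖ := by
  have hprod := deriv_arcRiemannMap_mul_deriv_inv e
  have hle := norm_deriv_arcRiemannMap_zero_le e hR hL
  have hn : ‖deriv (arcRiemannMap e) 0‖ * ‖deriv (invFunOn (arcRiemannMap e) (arcInv L ((e 0 : L) : ℂ))) 0‖ = 1 := by
    rw [← norm_mul, hprod, norm_one]
  have hpos : 0 < ‖deriv (arcRiemannMap e) 0‖ := by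
    refine norm_pos_iff.2 fun h ↦ ?_
    rw [h, zero_mul] at hprod
    exact zero_ne_one hprod
  have h1 : (1 : ℝ) ≤ R * ‖deriv (invFunOn (arcRiemannMap e) (arcInv L ((e 0 : L) : ℂ))) 0‖ :=
    calc (1 : ℝ) = ‖deriv (arcRiemannMap e) 0‖ * ‖deriv (invFunOn (arcRiemannMap e) (arcInv L ((e 0 : L) : ℂ))) 0‖ := hn.symm
      _ ≤ R * ‖deriv (invFunOn (arcRiemannMap e) (arcInv L ((e 0 : L) : ℂ))) 0‖ := by gcongr
  calc R⁻¹ = R⁻¹ * 1 := by ring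
    _ ≤ R⁻¹ * (R * ‖deriv (invFunOn (arcRiemannMap e) (arcInv L ((e 0 : L) : ℂ))) 0‖) := by gcongr
    _ = ‖deriv (invFunOn (arcRiemannMap e) (arcInv L ((e 0 : L) : ℂ))) 0‖ := by field_simp

/-- **Far lower bound**: `g(w) ≥ log 2` for `‖w - a‖ ≥ 2R` (then `‖T w‖ ≤ (2R)⁻¹` and
`‖φ(T w)‖ ≤ 1/2`). [folklore] -/
theorem le_arcGreen_of_far {w : ℂ} (hw : 2 * R ≤ ‖w - ((e 0 : L) : ℂ)‖) : Real.log 2 ≤ arcGreen e w := by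
  set a : ℂ := ((e 0 : L) : ℂ) with ha
  have hwa : 0 < ‖w - a‖ := lt_of_lt_of_le (by positivity) hw
  have hwL : w ∉ L := fun h ↦ by
    have := hL h
    rw [mem_closedBall, dist_eq_norm] at this
    linarith
  rw [arcGreen_of_notMem e hwL, arcGreenMap, le_neg, ← Real.log_inv]
  have hζ : ‖(w - a)⁻¹‖ < R⁻¹ := by
    rw [norm_inv, inv_lt_inv₀ hwa hR]
    linarith
  have h1 := norm_arcRiemannMap_le e hR hL hζ
  have h2 : R * ‖(w - a)⁻¹‖ ≤ 2⁻¹ := by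
    rw [norm_inv, ← div_eq_mul_inv, div_le_iff₀ hwa]
    linarith
  have hpos : 0 < ‖arcRiemannMap e (w - a)⁻¹‖ := (norm_arcGreenMap_mem e hwL).1
  exact Real.log_le_log hpos (h1.trans h2)

end Schwarz

/-! ### Koebe at a general point; the global upper bound -/

/-- **Koebe's one-quarter theorem at a general point of the disc** for the inverse Riemann map:
`B(ψ η, ‖ψ'(η)‖ (1 - ‖η‖²)/4) ⊆ Ω'` (`koebeQuarter_holds` for `ψ ∘ discMobius(-η)`).
[cite: PommerenkeBBCM1992, Cor. 1.4] -/
theorem ball_subset_arcInv_koebe {η : ℂ} (hη : ‖η‖ < 1) :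
    ball (invFunOn (arcRiemannMap e) (arcInv L ((e 0 : L) : ℂ)) η)
      (‖deriv (invFunOn (arcRiemannMap e) (arcInv L ((e 0 : L) : ℂ))) η‖ * (1 - ‖η‖ ^ 2) / 4) ⊆
      arcInv L ((e 0 : L) : ℂ) := by
  obtain ⟨hψd, hψinj, -, hψim, -, -⟩ := arcRiemannInv_spec e
  set ψ := invFunOn (arcRiemannMap e) (arcInv L ((e 0 : L) : ℂ)) with hψ
  have hη' : ‖-η‖ < 1 := by rwa [norm_neg]
  set m : ℂ → ℂ := Complex.discMobius (-η) with hm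
  have hmmaps : MapsTo m (ball 0 1) (ball 0 1) := Complex.mapsTo_discMobius hη'
  have hmd : DifferentiableOn ℂ m (ball 0 1) := Complex.differentiableOn_discMobius hη'
  have hminj : InjOn m (ball 0 1) := Complex.injOn_discMobius hη'
  have hm0 : m 0 = η := by simp [hm, Complex.discMobius_apply]
  set f : ℂ → ℂ := fun z ↦ ψ (m z) with hf
  have hfd : DifferentiableOn ℂ f (ball 0 1) := hψd.comp hmd hmmaps
  have hfinj : InjOn f (ball 0 1) := hψinj.comp hminj hmmaps
  have hK := Literature.Analysis.Complex.koebeQuarter_holds f hfd hfinj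
  have hf0 : f 0 = ψ η := by simp [hf, hm0]
  have hderiv : deriv f 0 = deriv ψ η * (1 - conj (-η) * (-η)) := by
    have h1 : HasDerivAt m (deriv m 0) 0 :=
      (hmd.differentiableAt (ball_mem_nhds 0 one_pos)).hasDerivAt
    have h2 : HasDerivAt ψ (deriv ψ η) (m 0) := by
      rw [hm0]
      exact (hψd.differentiableAt (isOpen_ball.mem_nhds (mem_ball_zero_iff.2 hη))).hasDerivAt
    rw [show f = ψ ∘ m from rfl, (h2.comp 0 h1).deriv, Complex.deriv_discMobius_zero]
  have hnorm : ‖deriv f 0‖ = ‖deriv ψ η‖ * (1 - ‖η‖ ^ 2) := by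
    rw [hderiv, map_neg, neg_mul_neg, norm_mul, Complex.norm_one_sub_conj_mul_self hη]
  rw [hf0, hnorm] at hK
  refine (by simpa [mul_div_assoc] using hK : ball (ψ η) (‖deriv ψ η‖ * (1 - ‖η‖ ^ 2) / 4) ⊆ f '' ball 0 1).trans ?_
  rintro _ ⟨z, hz, rfl⟩
  rw [← hψim]
  exact ⟨m z, hmmaps hz, rfl⟩

/-- `T b = (b - a)⁻¹` is not in `Ω'`. [folklore] -/
theorem inv_endpoint_notMem_arcInv :
    (((e 1 : L) : ℂ) - ((e 0 : L) : ℂ))⁻¹ ∉ arcInv L ((e 0 : L) : ℂ) := by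
  have : (((e 1 : L) : ℂ) - ((e 0 : L) : ℂ))⁻¹ ∈ (arcInv L ((e 0 : L) : ℂ))ᶜ := by
    rw [compl_arcInv_eq]
    exact ⟨_, endpoint_one_mem_diff e, rfl⟩
  exact this

/-- `‖ψ'(0)‖ ≤ 4/‖b - a‖` (Koebe at `0`: `B(0, ‖ψ'(0)‖/4) ⊆ Ω' ∌ T b`). [folklore] -/
theorem norm_deriv_arcRiemannInv_zero_le :
    ‖deriv (invFunOn (arcRiemannMap e) (arcInv L ((e 0 : L) : ℂ))) 0‖ ≤
      4 / ‖((e 1 : L) : ℂ) - ((e 0 : L) : ℂ)‖ := by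
  obtain ⟨-, -, hψ0, -, -, -⟩ := arcRiemannInv_spec e
  have hba : 0 < ‖((e 1 : L) : ℂ) - ((e 0 : L) : ℂ)‖ := norm_pos_iff.2 (sub_ne_zero.2 (arc_endpoints_ne e).symm)
  have hK := ball_subset_arcInv_koebe e (η := 0) (by simp)
  rw [hψ0, norm_zero] at hK
  simp only [ne_eq, OfNat.ofNat_ne_zero, not_false_eq_true, zero_pow, sub_zero, mul_one] at hK
  have hnot := inv_endpoint_notMem_arcInv e
  have : ¬ (((e 1 : L) : ℂ) - ((e 0 : L) : ℂ))⁻¹ ∈ ball (0 : ℂ)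
      (‖deriv (invFunOn (arcRiemannMap e) (arcInv L ((e 0 : L) : ℂ))) 0‖ / 4) := fun h ↦ hnot (hK h)
  rw [mem_ball_zero_iff, not_lt, norm_inv] at this
  rw [le_div_iff₀ hba]
  calc ‖deriv (invFunOn (arcRiemannMap e) (arcInv L ((e 0 : L) : ℂ))) 0‖ * ‖((e 1 : L) : ℂ) - ((e 0 : L) : ℂ)‖
      ≤ 4 * ‖((e 1 : L) : ℂ) - ((e 0 : L) : ℂ)‖⁻¹ * ‖((e 1 : L) : ℂ) - ((e 0 : L) : ℂ)‖ := by
        gcongr; linarith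
    _ = 4 := by field_simp

/-- `-log t ≤ 2 (1 - t)` for `1/2 ≤ t ≤ 1`. [folklore] -/
theorem neg_log_le_two_mul_one_sub {t : ℝ} (ht : 1 / 2 ≤ t) (ht1 : t ≤ 1) :
    -Real.log t ≤ 2 * (1 - t) := by
  have ht0 : 0 < t := by linarith
  have h1 : Real.log t⁻¹ ≤ t⁻¹ - 1 := Real.log_le_sub_one_of_pos (inv_pos.2 ht0)
  rw [Real.log_inv] at h1
  have h2 : t⁻¹ - 1 = (1 - t) / t := by field_simp
  rw [h2, le_div_iff₀ ht0] at h1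
  have h3 : 0 ≤ -Real.log t := neg_nonneg.2 (Real.log_nonpos ht0.le ht1)
  nlinarith

/-- **Global upper bound**: `g(w) ≤ max (log 2) (log (16‖w - a‖/‖b - a‖))` for every `w ∉ L`
(growth theorem for `ψ`: `‖ψ η‖ (1 - ‖η‖)² ≤ ‖ψ'(0)‖‖η‖ ≤ 4‖η‖/‖b - a‖`). [folklore] -/
theorem arcGreen_le_max_log {w : ℂ} (hw : w ∉ L) :
    arcGreen e w ≤ max (Real.log 2) (Real.log (16 * ‖w - ((e 0 : L) : ℂ)‖ / ‖((e 1 : L) : ℂ) - ((e 0 : L) : ℂ)‖)) := by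
  set a : ℂ := ((e 0 : L) : ℂ) with ha
  set b : ℂ := ((e 1 : L) : ℂ) with hb
  obtain ⟨hψd, hψinj, hψ0, -, -, hψφ⟩ := arcRiemannInv_spec e
  set ψ := invFunOn (arcRiemannMap e) (arcInv L a) with hψ
  have haL : a ∈ L := (e 0).2
  have hwa : 0 < ‖w - a‖ := norm_pos_iff.2 (sub_ne_zero.2 fun h ↦ hw (h ▸ haL))
  have hba : 0 < ‖b - a‖ := norm_pos_iff.2 (sub_ne_zero.2 (arc_endpoints_ne e).symm)
  set ζ : ℂ := (w - a)⁻¹ with hζ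
  set η : ℂ := arcRiemannMap e ζ with hη
  have hζmem : ζ ∈ arcInv L a := inv_sub_mem_arcInv haL hw
  have hηn : ‖η‖ ∈ Ioo (0 : ℝ) 1 := norm_arcGreenMap_mem e hw
  have hψη : ψ η = ζ := hψφ ζ hζmem
  rw [arcGreen_of_notMem e hw, arcGreenMap]
  change -Real.log ‖η‖ ≤ _
  by_cases hhalf : 1 / 2 < ‖η‖
  · refine le_trans ?_ (le_max_left _ _)
    rw [neg_le, ← Real.log_inv]
    exact Real.log_le_log (by norm_num) (by rw [inv_eq_one_div]; exact hhalf.le)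
  · rw [not_lt] at hhalf
    refine le_trans ?_ (le_max_right _ _)
    -- growth theorem: `‖ζ‖ (1 - ‖η‖)² ≤ ‖ψ'(0)‖ ‖η‖ ≤ 4 ‖η‖ / ‖b - a‖`
    have hgrowth := Literature.Analysis.Complex.AreaThm.norm_sub_le_growth hψd hψinj hηn.2
    rw [hψ0, sub_zero, hψη] at hgrowth
    have hψ'le := norm_deriv_arcRiemannInv_zero_le e
    have h1η : 0 < 1 - ‖η‖ := by linarith [hηn.2]
    have hζn : ‖ζ‖ = ‖w - a‖⁻¹ := by rw [hζ, norm_inv]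
    have hkey : ‖w - a‖⁻¹ * (1 - ‖η‖) ^ 2 ≤ 4 / ‖b - a‖ * ‖η‖ := by
      rw [← hζn]
      calc ‖ζ‖ * (1 - ‖η‖) ^ 2 ≤ ‖deriv ψ 0‖ * (‖η‖ / (1 - ‖η‖) ^ 2) * (1 - ‖η‖) ^ 2 := by gcongr
        _ = ‖deriv ψ 0‖ * ‖η‖ := by field_simp
        _ ≤ 4 / ‖b - a‖ * ‖η‖ := by gcongr
    -- with `‖η‖ ≤ 1/2`: `(1 - ‖η‖)² ≥ 1/4`, so `‖b - a‖ ≤ 16 ‖w - a‖ ‖η‖`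
    have hηge : ‖b - a‖ ≤ 16 * ‖w - a‖ * ‖η‖ := by
      have h14 : (1 : ℝ) / 4 ≤ (1 - ‖η‖) ^ 2 := by nlinarith
      have h3 : ‖w - a‖⁻¹ * (1 / 4) ≤ 4 / ‖b - a‖ * ‖η‖ :=
        (mul_le_mul_of_nonneg_left h14 (inv_nonneg.2 hwa.le)).trans hkey
      have h4 := mul_le_mul_of_nonneg_left h3 (by positivity : (0 : ℝ) ≤ 4 * ‖w - a‖ * ‖b - a‖)
      have h5 : 4 * ‖w - a‖ * ‖b - a‖ * (‖w - a‖⁻¹ * (1 / 4)) = ‖b - a‖ := by field_simp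
      have h6 : 4 * ‖w - a‖ * ‖b - a‖ * (4 / ‖b - a‖ * ‖η‖) = 16 * ‖w - a‖ * ‖η‖ := by field_simp; ring
      rw [h5, h6] at h4
      exact h4
    rw [neg_le, ← Real.log_inv]
    refine Real.log_le_log (by positivity) ?_
    rw [inv_div, div_le_iff₀ (by positivity)]
    linarith

/-! ### The modulus of continuity at the arc -/

section Near

variable {R : ℝ} (hR : 0 < R) (hL : L ⊆ closedBall ((e 0 : L) : ℂ) R)
include hR hL

/-- **Near-arc upper bound, squared form**: for `w ∉ L` and `x ∈ L ∖ {a}`,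
`(1 - ‖φ(T w)‖)² ≤ 32 R ‖w - x‖/(‖w - a‖ ‖x - a‖)` (Koebe at `η = φ(Tw)` — the Koebe disc about
`T w` misses `T x ∉ Ω'` — and the distortion lower bound `‖ψ'(η)‖ ≥ ‖ψ'(0)‖(1-‖η‖)/(1+‖η‖)³`,
`‖ψ'(0)‖ ≥ R⁻¹`). [folklore] -/
theorem one_sub_norm_sq_le {w x : ℂ} (hw : w ∉ L) (hx : x ∈ L) (hxa : x ≠ ((e 0 : L) : ℂ)) :
    (1 - ‖arcGreenMap e w‖) ^ 2 ≤
      32 * R * ‖w - x‖ / (‖w - ((e 0 : L) : ℂ)‖ * ‖x - ((e 0 : L) : ℂ)‖) := by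
  set a : ℂ := ((e 0 : L) : ℂ) with ha
  obtain ⟨hψd, hψinj, -, -, -, hψφ⟩ := arcRiemannInv_spec e
  set ψ := invFunOn (arcRiemannMap e) (arcInv L a) with hψ
  have haL : a ∈ L := (e 0).2
  have hwa : 0 < ‖w - a‖ := norm_pos_iff.2 (sub_ne_zero.2 fun h ↦ hw (h ▸ haL))
  have hxa' : 0 < ‖x - a‖ := norm_pos_iff.2 (sub_ne_zero.2 hxa)
  set ζ : ℂ := (w - a)⁻¹ with hζ
  set η : ℂ := arcRiemannMap e ζ with hη
  have hζmem : ζ ∈ arcInv L a := inv_sub_mem_arcInv haL hw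
  have hηn : ‖η‖ ∈ Ioo (0 : ℝ) 1 := norm_arcGreenMap_mem e hw
  have hψη : ψ η = ζ := hψφ ζ hζmem
  -- the Koebe disc about `ζ` misses `T x`
  have hTx : (x - a)⁻¹ ∉ arcInv L a := by
    have : (x - a)⁻¹ ∈ (arcInv L a)ᶜ := by
      rw [compl_arcInv_eq]; exact ⟨x, ⟨hx, hxa⟩, rfl⟩
    exact this
  have hK := ball_subset_arcInv_koebe e hηn.2
  rw [← ha, ← hψ, hψη] at hK
  have hdist : ‖deriv ψ η‖ * (1 - ‖η‖ ^ 2) / 4 ≤ ‖(x - a)⁻¹ - ζ‖ := by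
    by_contra hlt
    rw [not_le] at hlt
    exact hTx (hK (by rw [mem_ball, dist_eq_norm]; exact hlt))
  -- `‖T x - T w‖ = ‖w - x‖ / (‖w - a‖ ‖x - a‖)`
  have hTT : ‖(x - a)⁻¹ - ζ‖ = ‖w - x‖ / (‖w - a‖ * ‖x - a‖) := by
    have hxa0 : x - a ≠ 0 := sub_ne_zero.2 hxa
    have hwa0 : w - a ≠ 0 := norm_pos_iff.1 hwa
    rw [hζ, inv_sub_inv hxa0 hwa0, norm_div, norm_mul, mul_comm ‖x - a‖]
    congr 1
    congr 1
    ring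
  -- distortion: `‖ψ'(η)‖ ≥ ‖ψ'(0)‖ (1 - ‖η‖)/(1 + ‖η‖)³ ≥ R⁻¹ (1 - ‖η‖)/8`
  have hdis := Literature.Analysis.Complex.AreaThm.distortion_le_norm_deriv hψd hψinj hηn.2
  have hψ0 := inv_le_norm_deriv_arcRiemannInv_zero e hR hL
  have h1η : 0 ≤ 1 - ‖η‖ := by linarith [hηn.2]
  have hq : (1 - ‖η‖) / 8 ≤ (1 - ‖η‖) / (1 + ‖η‖) ^ 3 := by
    apply div_le_div_of_nonneg_left h1η (by positivity)
    nlinarith [hηn.1, hηn.2]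
  have hder : R⁻¹ * ((1 - ‖η‖) / 8) ≤ ‖deriv ψ η‖ :=
    calc R⁻¹ * ((1 - ‖η‖) / 8) ≤ ‖deriv ψ 0‖ * ((1 - ‖η‖) / (1 + ‖η‖) ^ 3) := by gcongr
      _ ≤ ‖deriv ψ η‖ := hdis
  -- combine
  have hsq : 1 - ‖η‖ ≤ 1 - ‖η‖ ^ 2 := by nlinarith [hηn.1, hηn.2]
  have hmain : R⁻¹ * (1 - ‖η‖) ^ 2 / 32 ≤ ‖w - x‖ / (‖w - a‖ * ‖x - a‖) := by
    rw [← hTT]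
    calc R⁻¹ * (1 - ‖η‖) ^ 2 / 32 = R⁻¹ * ((1 - ‖η‖) / 8) * (1 - ‖η‖) / 4 := by ring
      _ ≤ ‖deriv ψ η‖ * (1 - ‖η‖ ^ 2) / 4 := by gcongr
      _ ≤ ‖(x - a)⁻¹ - ζ‖ := hdist
  change (1 - ‖η‖) ^ 2 ≤ _
  have := mul_le_mul_of_nonneg_left hmain (by positivity : (0 : ℝ) ≤ 32 * R)
  calc (1 - ‖η‖) ^ 2 = 32 * R * (R⁻¹ * (1 - ‖η‖) ^ 2 / 32) := by field_simp
    _ ≤ 32 * R * (‖w - x‖ / (‖w - a‖ * ‖x - a‖)) := this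
    _ = 32 * R * ‖w - x‖ / (‖w - a‖ * ‖x - a‖) := by ring

/-- **Modulus of continuity of the Green function at the arc**: for `w ∉ L`, `x ∈ L ∖ {a}` with
`32 R ‖w - x‖/(‖w - a‖‖x - a‖) ≤ 1/4`, `g(w) ≤ 2 √(32 R ‖w - x‖/(‖w - a‖ ‖x - a‖))`. [folklore] -/
theorem arcGreen_le_of_near {w x : ℂ} (hw : w ∉ L) (hx : x ∈ L) (hxa : x ≠ ((e 0 : L) : ℂ))
    (hsmall : 32 * R * ‖w - x‖ / (‖w - ((e 0 : L) : ℂ)‖ * ‖x - ((e 0 : L) : ℂ)‖) ≤ 1 / 4) :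
    arcGreen e w ≤ 2 * Real.sqrt (32 * R * ‖w - x‖ / (‖w - ((e 0 : L) : ℂ)‖ * ‖x - ((e 0 : L) : ℂ)‖)) := by
  set D : ℝ := 32 * R * ‖w - x‖ / (‖w - ((e 0 : L) : ℂ)‖ * ‖x - ((e 0 : L) : ℂ)‖) with hD
  have hsq := one_sub_norm_sq_le e hR hL hw hx hxa
  have hηn : ‖arcGreenMap e w‖ ∈ Ioo (0 : ℝ) 1 := norm_arcGreenMap_mem e hw
  have hD0 : 0 ≤ D := by rw [hD]; positivity
  have h1 : 1 - ‖arcGreenMap e w‖ ≤ Real.sqrt D := by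
    rw [← Real.sqrt_sq (by linarith [hηn.2] : (0 : ℝ) ≤ 1 - ‖arcGreenMap e w‖)]
    exact Real.sqrt_le_sqrt hsq
  have hsqrt : Real.sqrt D ≤ 1 / 2 := by
    rw [show (1 : ℝ) / 2 = Real.sqrt (1 / 4) by
      rw [show (1 : ℝ) / 4 = (1 / 2) ^ 2 by norm_num, Real.sqrt_sq (by norm_num)]]
    exact Real.sqrt_le_sqrt hsmall
  have hhalf : 1 / 2 ≤ ‖arcGreenMap e w‖ := by linarith
  rw [arcGreen_of_notMem e hw]
  calc -Real.log ‖arcGreenMap e w‖ ≤ 2 * (1 - ‖arcGreenMap e w‖) :=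
        neg_log_le_two_mul_one_sub hhalf hηn.2.le
    _ ≤ 2 * Real.sqrt D := by gcongr

end Near

end Literature.Analysis.Complex
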